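import Summits.RiemannHypothesis.RiemannHypothesis.Theorems.WindowTraceArch.Negative.LocalWeyl
import HarnessLib

/-!
# `WindowStep`, line `christoffel-margin` — stub `stub_archFloor`

Support file for the crux `stmt-RiemannHypothesis-14659`
(`Summit.RiemannHypothesis.RiemannHypothesis.Theses.SpectralTrace.WindowStep`), line
`christoffel-margin`: the ARCHIMEDEAN FLOOR of Weil's quadratic functional `Q(g) = W(g ⋆ g̃)`
along the modulates `w_T(t) = e^{-iTt} w(t)` of a fixed narrow Weil test `w`
(`tsupport w ⊆ [-(log 2)/2, (log 2)/2]`, so no prime enters and `Re Q(w_T)` is Yoshida's analytic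
form `weilArchQuadratic w_T`):

* `log_sub_six_le_reDigammaQuarter` : `log(1 + |u|) - 6 ≤ Re ψ(1/4 + iu/2)`, the lower companion
  of `reDigammaQuarter_le_log` (lower Stirling-type bound `log_norm_sub_le_re_digamma` for
  `|u| ≥ 1`; `reDigammaQuarter_zero_le` and `re_digamma_one_quarter_ge` for `|u| ≤ 1`);
* `stub_archFloor` : `∃ K = K(w), ∀ T, (P/2π) log(1+|T|) - K ≤ Re Q(w_T)`, with
  `P = ∫ |ŵ(1/2+iv)|² dv` (registered signature, uncurried);
* `archFloor` : the curried form.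

Method: the upper bound of `WindowTraceArch/Negative/LocalWeyl.lean`
(`card_near_le_log_of_windowTrace`, steps (3)–(4)) run downward.
`Re Q(w_T) = 2Re(ŵ_T(0) conj ŵ_T(1)) - log π ‖w_T‖₂² + (1/2π) ∫ |ŵ_T(1/2+iu)|² Re ψ(1/4+iu/2) du`
(`weilQuadratic_re_eq_weilArchQuadratic`); the polar part is `≥ -2‖w‖²_{L¹,1/2}`
(`norm_weilMellin_le_weilL1`, `norm_modulate`), `‖w_T‖₂ = ‖w‖₂` (`norm_modulate`), and by the
minorant principle (`integral_norm_sq_weilMellin_mul_mono`) with the minorant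
`σ_T(u) = log(1+|T|) - log(1+|u-T|) - 6 ≤ log(1+|u|) - 6 ≤ Re ψ(1/4+iu/2)` the archimedean
integral is `≥ ∫ |ŵ(1/2+i(u-T))|² σ_T(u) du = P log(1+|T|) - ∫ |ŵ(1/2+iv)|² (log(1+|v|) + 6) dv`
(`weilMellin_modulate`, `integral_sub_right_eq_self`).
-/

set_option linter.dupNamespace false

noncomputable section

open Complex Set MeasureTheory Filter
open scoped Real Topology ComplexConjugate

namespace Summit.RiemannHypothesis.RiemannHypothesis.Theorems.SpectralTraceWindowStep

open Literature.NumberTheory.LFunctions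
open Literature.Analysis.SpecialFunctions
open Summit.RiemannHypothesis.RiemannHypothesis.Theorems.WindowTraceArch.Negative

/-! ### A lower bound for the archimedean weight `Re ψ(1/4 + iu/2)` -/

/-- `log(1 + |u|) - 6 ≤ Re ψ(1/4 + iu/2)` for all real `u`: for `|u| ≥ 1` the lower Stirling-type
bound `Re ψ(w) ≥ log ‖w‖ - 1/(2‖w‖²) - π/(4|Im w|)` (`log_norm_sub_le_re_digamma`) at
`w = 1/4 + iu/2` (`‖w‖ ≥ |u|/2 ≥ 1/2`, `log ‖w‖ ≥ log(1+|u|) - 2 log 2`); for `|u| ≤ 1`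
monotonicity in `|u|` (`reDigammaQuarter_zero_le`) and `ψ(1/4) ≥ -4.2275`
(`re_digamma_one_quarter_ge`). [folklore] -/
theorem log_sub_six_le_reDigammaQuarter (u : ℝ) :
    Real.log (1 + |u|) - 6 ≤ reDigammaQuarter u := by
  rcases le_or_gt 1 |u| with hu | hu
  · set w : ℂ := 1 / 4 + u / 2 * I with hw
    have hre : w.re = 1 / 4 := by simp [hw]
    have him : w.im = u / 2 := by simp [hw]
    have hw0 : 0 < w.re := by rw [hre]; norm_num
    have hu0 : 0 < |u| := by linarith
    have hwi : w.im ≠ 0 := by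
      rw [him]
      intro h0
      have : u = 0 := by linarith
      rw [this, abs_zero] at hu
      linarith
    have h := Literature.Analysis.SpecialFunctions.Complex.log_norm_sub_le_re_digamma hw0 hwi
    -- `‖w‖ ≥ |u|/2 ≥ 1/2`
    have hn2 : |u| / 2 ≤ ‖w‖ := by
      have := Complex.abs_im_le_norm w
      rw [him, abs_div, abs_two] at this
      exact this
    have hnpos : 0 < ‖w‖ := by linarith
    -- `log ‖w‖ ≥ log (|u|/2) = log |u| - log 2 ≥ log (1 + |u|) - 2 log 2`
    have hlog : Real.log (1 + |u|) - 2 * Real.log 2 ≤ Real.log ‖w‖ := by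
      have h1 : Real.log (|u| / 2) ≤ Real.log ‖w‖ := Real.log_le_log (by linarith) hn2
      have h2 : Real.log (|u| / 2) = Real.log |u| - Real.log 2 :=
        Real.log_div hu0.ne' two_ne_zero
      have h3 : Real.log (1 + |u|) ≤ Real.log 2 + Real.log |u| := by
        rw [← Real.log_mul two_ne_zero hu0.ne']
        exact Real.log_le_log (by linarith) (by linarith)
      linarith
    have h2 : 1 / (2 * ‖w‖ ^ 2) ≤ 2 := by
      rw [div_le_iff₀ (by positivity)]
      nlinarith
    have h3 : π / (4 * |w.im|) ≤ 2 := by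
      rw [him, abs_div, abs_two, div_le_iff₀ (by positivity)]
      nlinarith [Real.pi_lt_d2]
    have : reDigammaQuarter u = (Complex.digamma w).re := rfl
    have hl2 := Real.log_two_lt_d9
    linarith
  · have hmono : reDigammaQuarter 0 ≤ reDigammaQuarter u := reDigammaQuarter_zero_le u
    rw [reDigammaQuarter_zero] at hmono
    have hq := re_digamma_one_quarter_ge
    have hlog : Real.log (1 + |u|) ≤ Real.log 2 :=
      Real.log_le_log (by linarith [abs_nonneg u]) (by linarith)
    have hl2 := Real.log_two_lt_d9
    linarith

/-! ### The archimedean floor of `Re Q` along modulates -/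

/-- **stub_archFloor — the archimedean floor of `Re Q` along modulates (RH-free).** For a Weil
test `w` supported in `[-(log 2)/2, (log 2)/2]` (so NO prime enters `Q(w_T)`:
`weilQuadratic_re_eq_weilArchQuadratic`) there is `K = K(w)` with
`(P/2π) log(1+|T|) - K ≤ Re Q(w_T)` for every `T`, where `w_T(t) = e^{-iTt} w(t)` and
`P = ∫ |ŵ(1/2+iv)|² dv`. Proof (the upper bound of `LocalWeyl.lean` run downward):
`Re Q(w_T) = 2 Re(ŵ_T(0) conj ŵ_T(1)) - log π ‖w‖₂² + (1/2π) ∫ |ŵ_T(1/2+iu)|² Re ψ(1/4+iu/2) du`;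
polar `≥ -2 (weilL1 w)²` (`norm_weilMellin_le_weilL1`, `norm_modulate`); archimedean: the
minorant `σ_T(u) := log(1+|T|) - log(1+|u-T|) - 6 ≤ log(1+|u|) - 6 ≤ Re ψ(1/4+iu/2)`
(`log_sub_six_le_reDigammaQuarter`) in `integral_norm_sq_weilMellin_mul_mono`, then
`weilMellin_modulate` and `integral_sub_right_eq_self`; the constant is
`K = 2 (weilL1 w)² + log π ‖w‖₂² + (1/2π) ∫ |ŵ(1/2+iv)|² (log(1+|v|) + 6) dv`. [folklore] -/
theorem stub_archFloor :
    ∀ w : ℝ → ℂ, Literature.NumberTheory.LFunctions.IsWeilTest w →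
      tsupport w ⊆ Set.Icc (-(Real.log 2 / 2)) (Real.log 2 / 2) →
        ∃ K : ℝ, ∀ T : ℝ,
          1 / (2 * Real.pi) *
                (∫ v : ℝ, ‖Literature.NumberTheory.LFunctions.weilMellin w (1 / 2 + v * Complex.I)‖ ^ 2) *
              Real.log (1 + |T|) - K ≤
            (Literature.NumberTheory.LFunctions.weilQuadratic
              (fun t : ℝ => Complex.exp (-((T * t : ℝ) : ℂ) * Complex.I) * w t)).re := by
  intro w hw hws
  -- constants (depend on `w` only)
  set L : ℝ := weilL1 w with hL
  have hL0 : 0 ≤ L := weilL1_nonneg w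
  set P : ℝ := ∫ v : ℝ, ‖weilMellin w (1 / 2 + v * I)‖ ^ 2 with hP
  set N : ℝ := ∫ t : ℝ, ‖w t‖ ^ 2 with hN
  set K₁ : ℝ := ∫ v : ℝ, ‖weilMellin w (1 / 2 + v * I)‖ ^ 2 * (Real.log (1 + |v|) + 6) with hK₁
  refine ⟨2 * L ^ 2 + Real.log π * N + 1 / (2 * π) * K₁, fun T => ?_⟩
  -- the modulated test
  set wT : ℝ → ℂ := fun t => cexp (-((T * t : ℝ) : ℂ) * I) * w t with hwT_def
  have hwT : IsWeilTest wT := isWeilTest_modulate hw T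
  have hwTsl : tsupport wT ⊆ Icc (-(Real.log 2 / 2)) (Real.log 2 / 2) :=
    (tsupport_modulate_subset w T).trans hws
  -- `Re Q(w_T)` in Yoshida's analytic form
  have hQ : (weilQuadratic wT).re = weilArchQuadratic wT :=
    weilQuadratic_re_eq_weilArchQuadratic hwT hwTsl
  -- (a) the polar part is `≥ -2 L²`
  have hLT : weilL1 wT = L := by
    rw [hL, weilL1, weilL1]
    refine integral_congr_ae (Eventually.of_forall fun t => ?_)
    simp only [hwT_def, norm_modulate]
  have hpol : -(2 * L ^ 2) ≤ 2 * (weilMellin wT 0 * conj (weilMellin wT 1)).re := by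
    have h0 : ‖weilMellin wT 0‖ ≤ L := by
      rw [← hLT]; exact norm_weilMellin_le_weilL1 hwT.1.continuous hwT.2 (by simp) (by simp)
    have h1 : ‖weilMellin wT 1‖ ≤ L := by
      rw [← hLT]; exact norm_weilMellin_le_weilL1 hwT.1.continuous hwT.2 (by simp) (by simp)
    have h2 : |(weilMellin wT 0 * conj (weilMellin wT 1)).re| ≤
        ‖weilMellin wT 0‖ * ‖weilMellin wT 1‖ := by
      refine (Complex.abs_re_le_norm _).trans ?_
      rw [norm_mul, Complex.norm_conj]
    have h3 := neg_abs_le (weilMellin wT 0 * conj (weilMellin wT 1)).re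
    nlinarith [norm_nonneg (weilMellin wT 0), norm_nonneg (weilMellin wT 1)]
  -- (b) the `L²` part does not depend on `T`
  have hNT : ∫ t, ‖wT t‖ ^ 2 = N := by
    rw [hN]
    refine integral_congr_ae (Eventually.of_forall fun t => ?_)
    simp only [hwT_def, norm_modulate]
  have hN' : Real.log π * ∫ t, ‖wT t‖ ^ 2 = Real.log π * N := by rw [hNT]
  -- (c) the archimedean integral, bounded below by the minorant principle
  have hlogT : 0 ≤ Real.log (1 + |T|) := Real.log_nonneg (by linarith [abs_nonneg T])
  set σ : ℝ → ℝ := fun u => Real.log (1 + |T|) - Real.log (1 + |u - T|) - 6 with hσ_def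
  have hσm : Measurable σ := by
    rw [hσ_def]
    fun_prop
  have hσb : ∀ u, |σ u| ≤ (Real.log (1 + |T|) + |T| + 7) + 1 * u ^ 2 := by
    intro u
    have h1 : 0 ≤ Real.log (1 + |u - T|) := Real.log_nonneg (by linarith [abs_nonneg (u - T)])
    have h3 : Real.log (1 + |u - T|) ≤ |u - T| := by
      have := Real.log_le_sub_one_of_pos (by linarith [abs_nonneg (u - T)] : (0 : ℝ) < 1 + |u - T|)
      linarith
    have h4 : |u - T| ≤ |u| + |T| := abs_sub u T
    have h5 : |u| ≤ 1 + u ^ 2 := by nlinarith [sq_nonneg (|u| - 1), sq_abs u, abs_nonneg u]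
    have hσu : σ u = Real.log (1 + |T|) - Real.log (1 + |u - T|) - 6 := rfl
    rw [abs_le, hσu]
    constructor <;> nlinarith [abs_nonneg T]
  have hσle : ∀ u, σ u ≤ reDigammaQuarter u := by
    intro u
    have h1 := log_sub_six_le_reDigammaQuarter u
    have h2 : Real.log (1 + |T|) ≤ Real.log (1 + |u - T|) + Real.log (1 + |u|) := by
      rw [← Real.log_mul (by positivity) (by positivity)]
      refine Real.log_le_log (by positivity) ?_
      have h4 : |T| ≤ |u| + |u - T| := by
        have := abs_sub u (u - T)
        rwa [sub_sub_cancel] at this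
      nlinarith [abs_nonneg (u - T), abs_nonneg u, mul_nonneg (abs_nonneg (u - T)) (abs_nonneg u)]
    have hσu : σ u = Real.log (1 + |T|) - Real.log (1 + |u - T|) - 6 := rfl
    rw [hσu]
    linarith
  have hmono := integral_norm_sq_weilMellin_mul_mono hwT hσm (by positivity) zero_le_one hσb hσle
  -- the left-hand side of the minorant inequality, computed by the shift `u ↦ u - T`
  have hleft : ∫ u : ℝ, ‖weilMellin wT (1 / 2 + u * I)‖ ^ 2 * σ u =
      Real.log (1 + |T|) * P - K₁ := by
    calc ∫ u : ℝ, ‖weilMellin wT (1 / 2 + u * I)‖ ^ 2 * σ u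
        = ∫ u : ℝ, ‖weilMellin w (1 / 2 + ((u - T : ℝ) : ℂ) * I)‖ ^ 2 *
            (Real.log (1 + |T|) - Real.log (1 + |u - T|) - 6) := by
          refine integral_congr_ae (Eventually.of_forall fun u => ?_)
          have hσu : σ u = Real.log (1 + |T|) - Real.log (1 + |u - T|) - 6 := rfl
          simp only [hσu]
          rw [weilMellin_modulate w T u]
      _ = ∫ v : ℝ, ‖weilMellin w (1 / 2 + v * I)‖ ^ 2 *
            (Real.log (1 + |T|) - Real.log (1 + |v|) - 6) := by
          have := integral_sub_right_eq_self (μ := (volume : Measure ℝ))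
            (fun v : ℝ => ‖weilMellin w (1 / 2 + v * I)‖ ^ 2 *
              (Real.log (1 + |T|) - Real.log (1 + |v|) - 6)) T
          simpa using this
      _ = Real.log (1 + |T|) * P - K₁ := by
          have e : (fun v : ℝ => ‖weilMellin w (1 / 2 + v * I)‖ ^ 2 *
              (Real.log (1 + |T|) - Real.log (1 + |v|) - 6)) =
              fun v : ℝ => Real.log (1 + |T|) * ‖weilMellin w (1 / 2 + v * I)‖ ^ 2 -
                ‖weilMellin w (1 / 2 + v * I)‖ ^ 2 * (Real.log (1 + |v|) + 6) := by
            funext v; ring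
          have hi1 : Integrable fun v : ℝ => ‖weilMellin w (1 / 2 + v * I)‖ ^ 2 *
              (Real.log (1 + |v|) + 6) := by
            refine integrable_norm_sq_weilMellin_mul hw (by fun_prop) (by norm_num : (0:ℝ) ≤ 7)
              (by norm_num : (0:ℝ) ≤ 1 / 2) fun v => ?_
            have h1 : 0 ≤ Real.log (1 + |v|) := Real.log_nonneg (by linarith [abs_nonneg v])
            have h3 : Real.log (1 + |v|) ≤ |v| := by
              have := Real.log_le_sub_one_of_pos (by linarith [abs_nonneg v] : (0 : ℝ) < 1 + |v|)
              linarith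
            rw [abs_of_nonneg (by linarith)]
            nlinarith [sq_nonneg (|v| - 1), sq_abs v]
          have hi2 : Integrable fun v : ℝ =>
              Real.log (1 + |T|) * ‖weilMellin w (1 / 2 + v * I)‖ ^ 2 :=
            (integrable_norm_sq_weilMellin_half_line hw).const_mul _
          rw [e, integral_sub hi2 hi1, MeasureTheory.integral_const_mul]
  have harch : Real.log (1 + |T|) * P - K₁ ≤ ∫ u : ℝ, ‖weilMellin wT (1 / 2 + u * I)‖ ^ 2 *
      (Complex.digamma (1 / 4 + u / 2 * I)).re := by
    rw [← hleft]
    exact hmono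
  -- (d) assemble
  have harch' : 1 / (2 * π) * (Real.log (1 + |T|) * P - K₁) ≤
      1 / (2 * π) * ∫ u : ℝ, ‖weilMellin wT (1 / 2 + u * I)‖ ^ 2 *
        (Complex.digamma (1 / 4 + u / 2 * I)).re :=
    mul_le_mul_of_nonneg_left harch (by positivity)
  rw [hQ, weilArchQuadratic]
  linarith

/-- Curried form of `stub_archFloor`: for a Weil test `w` supported in `[-(log 2)/2, (log 2)/2]`
there is `K` with `(P/2π) log(1+|T|) - K ≤ Re Q(w_T)` for all `T` (`w_T(t) = e^{-iTt} w(t)`,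
`P = ∫ |ŵ(1/2+iv)|² dv`). [folklore] -/
theorem archFloor {w : ℝ → ℂ} (hw : IsWeilTest w)
    (hws : tsupport w ⊆ Icc (-(Real.log 2 / 2)) (Real.log 2 / 2)) :
    ∃ K : ℝ, ∀ T : ℝ,
      1 / (2 * π) * (∫ v : ℝ, ‖weilMellin w (1 / 2 + v * I)‖ ^ 2) * Real.log (1 + |T|) - K ≤
        (weilQuadratic (fun t : ℝ => cexp (-((T * t : ℝ) : ℂ) * I) * w t)).re :=
  stub_archFloor w hw hws

end Summit.RiemannHypothesis.RiemannHypothesis.Theorems.SpectralTraceWindowStep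

end
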